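import Summits.NavierStokesRegularity.NavierStokesRegularity.Theorems.ExtremiserTransienceKStarAttainedPerturbation
import Literature.Analysis.FluidPDE.WholeSpaceIBP
import Literature.Analysis.FluidPDE.VectorCalculusProofs
import Literature.Analysis.FluidPDE.NewtonKernel
import HarnessLib

/-!
# Route `ExtremiserTransience`, support item `KStarAttained` (stmt-NavierStokesRegularity-24370):
# THE FIRST-VARIATION FUNCTIONAL ON CURLS HAS A CONTINUOUS DENSITY

`--supports stmt-NavierStokesRegularity-24370`. Author: prover seat `ns-et-p1` (g3).

For a `C^∞` field `v` (`ω = curl v`) the linear coefficients `J₁(φ)`, `a₁(φ)`, `c₁(φ)` of the stretching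
integral, the enstrophy and the palinstrophy along `v + εφ` (`…KStarAttainedPerturbation`) are, on curls
`φ = curl η` with `η ∈ C^∞_c`, represented by CONTINUOUS fields paired with `η`:

* `integral_T1`: `∫⟪curl curl η, Dv ω⟫ = ∫⟪curl curl (Dv ω), η⟫`; `integral_T2`:
  `∫⟪ω, D(curl η) ω⟫ = −∫⟪curl (Dω ω), η⟫` (convection identity, `div ω = 0`); `integral_T3`:
  `∫⟪ω, Dv curl curl η⟫ = ∫⟪curl curl (Dvᵀω), η⟫` (`inner_fderiv_apply_eq_inner_transpose`);
  `integral_A1`: `∫⟪ω, curl curl η⟫ = ∫⟪curl curl ω, η⟫`; `integral_C1`: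
  `∫ Σᵢ⟪∂ᵢω, ∂ᵢ curl curl η⟫ = −∫⟪curl curl Δω, η⟫` (Green's first identity) — all by the tree's
  curl-adjointness `integral_inner_curl_eq_integral_inner_curl` and `WholeSpaceIBP`;
* `KStar.exists_density` — hence for all reals `c_J, c_a, c_c` there is a continuous `G` with
  `c_J·J₁(curl η) + c_a·a₁(curl η) + c_c·c₁(curl η) = ∫⟪G, η⟫` for every `η ∈ C^∞_c`.

This is the point where `C^∞`-smoothness (four derivatives) of a putative attainer of `κ⋆` is used: the
Euler–Lagrange functional is a distribution of order `0` with continuous density, so it cannot charge a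
nowhere-dense contact set (`…KStarAttainedContact`). WHAT THIS IS NOT: nothing about attainment,
Navier–Stokes solutions or regularity; NS regularity is NOT proved by anything here. [folklore]
-/

noncomputable section

open Set Filter Topology MeasureTheory Metric
open scoped InnerProductSpace RealInnerProductSpace ENNReal NNReal ContDiff Laplacian
open Literature.Analysis.FluidPDE

namespace Summit.NavierStokesRegularity.NavierStokesRegularity.Theorems

-- the problem directory repeats the summit name (`NavierStokesRegularity/NavierStokesRegularity`)
set_option linter.dupNamespace false

namespace DepletionLadder.KStar

variable {v : EuclideanSpace ℝ (Fin 3) → EuclideanSpace ℝ (Fin 3)}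

/-! ## Smoothness bookkeeping -/

/-- The curl of a `C^∞` field is `C^∞`. [folklore] -/
theorem contDiff_curl_top {w : EuclideanSpace ℝ (Fin 3) → EuclideanSpace ℝ (Fin 3)} (hw : ContDiff ℝ ∞ w) :
    ContDiff ℝ ∞ (curl w) := by
  rw [curl_eq_curlCLM_comp]
  exact curlCLM.contDiff.comp (hw.fderiv_right (m := ∞) le_rfl)

/-- The transpose field `x ↦ Dv(x)ᵀ ω(x) = Σⱼ ⟪ω, ∂ⱼv⟫ eⱼ` represents `w ↦ ⟪ω, Dv w⟫`:
`⟪ω, Dv w⟫ = ⟪Dvᵀω, w⟫`. [folklore] -/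
theorem inner_fderiv_apply_eq_inner_transpose (x w : EuclideanSpace ℝ (Fin 3)) :
    ⟪curl v x, fderiv ℝ v x w⟫ =
      ⟪∑ j, ⟪curl v x, fderiv ℝ v x (EuclideanSpace.basisFun (Fin 3) ℝ j)⟫ •
        EuclideanSpace.basisFun (Fin 3) ℝ j, w⟫ := by
  conv_lhs => rw [← (EuclideanSpace.basisFun (Fin 3) ℝ).sum_repr' w]
  simp only [map_sum, map_smul, inner_sum, sum_inner, inner_smul_right, inner_smul_left, RCLike.conj_to_real]
  exact Finset.sum_congr rfl fun j _ => by ring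

/-! ## The three integrations by parts: `ℓ(curl η) = ∫⟪G, η⟫` -/

section Density

variable {η : EuclideanSpace ℝ (Fin 3) → EuclideanSpace ℝ (Fin 3)}

/-- `∫⟪curl curl η, Dv ω⟫ = ∫⟪curl curl (Dv ω), η⟫` (curl-adjointness twice). [folklore] -/
theorem integral_T1 (hv : ContDiff ℝ ∞ v) (hη : ContDiff ℝ ∞ η) (hηc : HasCompactSupport η) :
    ∫ x, ⟪curl (curl η) x, fderiv ℝ v x (curl v x)⟫ =
      ∫ x, ⟪curl (curl fun y => fderiv ℝ v y (curl v y)) x, η x⟫ := by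
  have hs : ContDiff ℝ ∞ (fun y => fderiv ℝ v y (curl v y)) :=
    (hv.fderiv_right (m := ∞) le_rfl).clm_apply (contDiff_curl_top hv)
  have hs1 : ContDiff ℝ 1 (fun y => fderiv ℝ v y (curl v y)) := hs.of_le (by norm_cast)
  have hcs1 : ContDiff ℝ 1 (curl fun y => fderiv ℝ v y (curl v y)) := (contDiff_curl_top hs).of_le (by norm_cast)
  have hη1 : ContDiff ℝ 1 η := hη.of_le (by norm_cast)
  have hcη1 : ContDiff ℝ 1 (curl η) := (contDiff_curl_top hη).of_le (by norm_cast)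
  have hcηc : HasCompactSupport (curl η) := hasCompactSupport_curl hηc
  calc ∫ x, ⟪curl (curl η) x, fderiv ℝ v x (curl v x)⟫
      = ∫ x, ⟪fderiv ℝ v x (curl v x), curl (curl η) x⟫ :=
        integral_congr_ae (Eventually.of_forall fun x => real_inner_comm _ _)
    _ = ∫ x, ⟪curl (fun y => fderiv ℝ v y (curl v y)) x, curl η x⟫ :=
        (integral_inner_curl_eq_integral_inner_curl hs1 hcη1 hcηc).symm
    _ = ∫ x, ⟪curl (curl fun y => fderiv ℝ v y (curl v y)) x, η x⟫ :=
        (integral_inner_curl_eq_integral_inner_curl hcs1 hη1 hηc).symm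

/-- `∫⟪ω, D(curl η) ω⟫ = −∫⟪curl (Dω ω), η⟫` (the convection identity with `div ω = 0`, then
curl-adjointness). [folklore] -/
theorem integral_T2 (hv : ContDiff ℝ ∞ v) (hη : ContDiff ℝ ∞ η) (hηc : HasCompactSupport η) :
    ∫ x, ⟪curl v x, fderiv ℝ (curl η) x (curl v x)⟫ =
      -∫ x, ⟪curl (fun y => fderiv ℝ (curl v) y (curl v y)) x, η x⟫ := by
  have hω : ContDiff ℝ ∞ (curl v) := contDiff_curl_top hv
  have hω1 : ContDiff ℝ 1 (curl v) := hω.of_le (by norm_cast)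
  have hs : ContDiff ℝ ∞ (fun y => fderiv ℝ (curl v) y (curl v y)) :=
    (hω.fderiv_right (m := ∞) le_rfl).clm_apply hω
  have hs1 : ContDiff ℝ 1 (fun y => fderiv ℝ (curl v) y (curl v y)) := hs.of_le (by norm_cast)
  have hη1 : ContDiff ℝ 1 η := hη.of_le (by norm_cast)
  have hcη1 : ContDiff ℝ 1 (curl η) := (contDiff_curl_top hη).of_le (by norm_cast)
  have hcηc : HasCompactSupport (curl η) := hasCompactSupport_curl hηc
  have h := integral_inner_convect_add_eq_zero (u := curl v) (v := curl v) (w := curl η) hω1 hω1 hcη1 hcηc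
  have hdiv0 : ∫ x, VectorCalculus.divergence (curl v) x * ⟪curl v x, curl η x⟫ = 0 := by
    rw [integral_congr_ae (Eventually.of_forall fun x => ?_), integral_zero]
    simp [divergence_curl_eq_zero_holds v (hv.of_le (by norm_cast)) x]
  rw [hdiv0, add_zero] at h
  simp only [convect_apply] at h
  rw [integral_inner_curl_eq_integral_inner_curl hs1 hη1 hηc]
  linarith

/-- `∫⟪ω, Dv (curl curl η)⟫ = ∫⟪curl curl (Dvᵀω), η⟫` (transpose, then curl-adjointness twice). [folklore] -/
theorem integral_T3 (hv : ContDiff ℝ ∞ v) (hη : ContDiff ℝ ∞ η) (hηc : HasCompactSupport η) :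
    ∫ x, ⟪curl v x, fderiv ℝ v x (curl (curl η) x)⟫ =
      ∫ x, ⟪curl (curl fun y => ∑ j, ⟪curl v y, fderiv ℝ v y (EuclideanSpace.basisFun (Fin 3) ℝ j)⟫ •
        EuclideanSpace.basisFun (Fin 3) ℝ j) x, η x⟫ := by
  have hω : ContDiff ℝ ∞ (curl v) := contDiff_curl_top hv
  have hs : ContDiff ℝ ∞ (fun y => ∑ j, ⟪curl v y, fderiv ℝ v y (EuclideanSpace.basisFun (Fin 3) ℝ j)⟫ •
      EuclideanSpace.basisFun (Fin 3) ℝ j) :=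
    ContDiff.sum fun j _ => (hω.inner ℝ ((hv.fderiv_right (m := ∞) le_rfl).clm_apply contDiff_const)).smul
      contDiff_const
  have hs1 := hs.of_le (m := 1) (by norm_cast)
  have hcs1 := (contDiff_curl_top hs).of_le (m := 1) (by norm_cast)
  have hη1 : ContDiff ℝ 1 η := hη.of_le (by norm_cast)
  have hcη1 : ContDiff ℝ 1 (curl η) := (contDiff_curl_top hη).of_le (by norm_cast)
  have hcηc : HasCompactSupport (curl η) := hasCompactSupport_curl hηc
  calc ∫ x, ⟪curl v x, fderiv ℝ v x (curl (curl η) x)⟫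
      = ∫ x, ⟪∑ j, ⟪curl v x, fderiv ℝ v x (EuclideanSpace.basisFun (Fin 3) ℝ j)⟫ •
          EuclideanSpace.basisFun (Fin 3) ℝ j, curl (curl η) x⟫ :=
        integral_congr_ae (Eventually.of_forall fun x => inner_fderiv_apply_eq_inner_transpose x _)
    _ = ∫ x, ⟪curl (fun y => ∑ j, ⟪curl v y, fderiv ℝ v y (EuclideanSpace.basisFun (Fin 3) ℝ j)⟫ •
          EuclideanSpace.basisFun (Fin 3) ℝ j) x, curl η x⟫ :=
        (integral_inner_curl_eq_integral_inner_curl hs1 hcη1 hcηc).symm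
    _ = _ := (integral_inner_curl_eq_integral_inner_curl hcs1 hη1 hηc).symm

/-- `∫⟪ω, curl curl η⟫ = ∫⟪curl curl ω, η⟫`. [folklore] -/
theorem integral_A1 (hv : ContDiff ℝ ∞ v) (hη : ContDiff ℝ ∞ η) (hηc : HasCompactSupport η) :
    ∫ x, ⟪curl v x, curl (curl η) x⟫ = ∫ x, ⟪curl (curl (curl v)) x, η x⟫ := by
  have hω : ContDiff ℝ ∞ (curl v) := contDiff_curl_top hv
  have hω1 : ContDiff ℝ 1 (curl v) := hω.of_le (by norm_cast)
  have hcω1 : ContDiff ℝ 1 (curl (curl v)) := (contDiff_curl_top hω).of_le (by norm_cast)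
  have hη1 : ContDiff ℝ 1 η := hη.of_le (by norm_cast)
  have hcη1 : ContDiff ℝ 1 (curl η) := (contDiff_curl_top hη).of_le (by norm_cast)
  have hcηc : HasCompactSupport (curl η) := hasCompactSupport_curl hηc
  rw [← integral_inner_curl_eq_integral_inner_curl hω1 hcη1 hcηc,
    ← integral_inner_curl_eq_integral_inner_curl hcω1 hη1 hηc]

/-- `∫ Σᵢ⟪∂ᵢω, ∂ᵢ(curl curl η)⟫ = −∫⟪curl curl Δω, η⟫` (Green's first identity, then curl-adjointness
twice). [folklore] -/
theorem integral_C1 (hv : ContDiff ℝ ∞ v) (hη : ContDiff ℝ ∞ η) (hηc : HasCompactSupport η) :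
    ∫ x, ∑ i, ⟪fderiv ℝ (curl v) x (EuclideanSpace.basisFun (Fin 3) ℝ i),
        fderiv ℝ (curl (curl η)) x (EuclideanSpace.basisFun (Fin 3) ℝ i)⟫ =
      -∫ x, ⟪curl (curl (Δ (curl v))) x, η x⟫ := by
  have hω : ContDiff ℝ ∞ (curl v) := contDiff_curl_top hv
  have hω2 : ContDiff ℝ 2 (curl v) := hω.of_le (by norm_cast)
  have hΔ : ContDiff ℝ 2 (Δ (curl v)) := contDiff_laplacian (n := 2) (hω.of_le (by norm_cast))
  have hΔ1 : ContDiff ℝ 1 (Δ (curl v)) := hΔ.of_le (by norm_cast)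
  have hcΔ1 : ContDiff ℝ 1 (curl (Δ (curl v))) := contDiff_curl (n := 1) (by exact_mod_cast hΔ)
  have hη1 : ContDiff ℝ 1 η := hη.of_le (by norm_cast)
  have hcη : ContDiff ℝ ∞ (curl η) := contDiff_curl_top hη
  have hcη1 : ContDiff ℝ 1 (curl η) := hcη.of_le (by norm_cast)
  have hccη : ContDiff ℝ ∞ (curl (curl η)) := contDiff_curl_top hcη
  have hccη1 : ContDiff ℝ 1 (curl (curl η)) := hccη.of_le (by norm_cast)
  have hcηc : HasCompactSupport (curl η) := hasCompactSupport_curl hηc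
  have hccηc : HasCompactSupport (curl (curl η)) := hasCompactSupport_curl hcηc
  have hgreen := integral_inner_laplacian_add_eq_zero (EuclideanSpace.basisFun (Fin 3) ℝ)
    (v := curl v) (w := curl (curl η)) hω2 hccη1 (Or.inr hccηc)
  -- the sum of integrals is the integral of the sum (compact support)
  have hint : ∀ i, Integrable (fun x => ⟪fderiv ℝ (curl v) x (EuclideanSpace.basisFun (Fin 3) ℝ i),
      fderiv ℝ (curl (curl η)) x (EuclideanSpace.basisFun (Fin 3) ℝ i)⟫)
      (volume : Measure (EuclideanSpace ℝ (Fin 3))) := fun i =>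
    integrable_inner_of_hasCompactSupport_right
      ((hω2.continuous_fderiv (by norm_num)).clm_apply continuous_const)
      ((hccη1.continuous_fderiv one_ne_zero).clm_apply continuous_const)
      ((hccηc.fderiv (𝕜 := ℝ)).mono fun x hx => by
        contrapose! hx
        simp only [Function.mem_support, not_not] at hx
        simp [hx])
  rw [integral_finsetSum _ fun i _ => hint i,
    integral_inner_curl_eq_integral_inner_curl hcΔ1 hη1 hηc,
    integral_inner_curl_eq_integral_inner_curl hΔ1 hcη1 hcηc]
  linarith

/-- **Continuous density of the first-variation functional on curls.** For an admissible (indeed any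
`C^∞`) field `v` and real coefficients `c_J, c_a, c_c` there is a CONTINUOUS field `G` with
`c_J·J₁(curl η) + c_a·a₁(curl η) + c_c·c₁(curl η) = ∫⟪G, η⟫` for every `η ∈ C^∞_c`
(`J₁, a₁, c₁` as in `…KStarAttainedVariation`). [folklore] -/
theorem exists_density (hv : ContDiff ℝ ∞ v) (cJ ca cc : ℝ) :
    ∃ G : EuclideanSpace ℝ (Fin 3) → EuclideanSpace ℝ (Fin 3), Continuous G ∧
      ∀ η : EuclideanSpace ℝ (Fin 3) → EuclideanSpace ℝ (Fin 3), ContDiff ℝ ∞ η → HasCompactSupport η →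
        cJ * (∫ x, (⟪curl (curl η) x, fderiv ℝ v x (curl v x)⟫ + ⟪curl v x, fderiv ℝ (curl η) x (curl v x)⟫ +
          ⟪curl v x, fderiv ℝ v x (curl (curl η) x)⟫)) + ca * (∫ x, ⟪curl v x, curl (curl η) x⟫) + cc * (∫ x, ∑ i, ⟪fderiv ℝ (curl v) x (EuclideanSpace.basisFun (Fin 3) ℝ i),
          fderiv ℝ (curl (curl η)) x (EuclideanSpace.basisFun (Fin 3) ℝ i)⟫) = ∫ x, ⟪G x, η x⟫ := by
  have hω : ContDiff ℝ ∞ (curl v) := contDiff_curl_top hv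
  -- the five smooth fields
  set s₁ : EuclideanSpace ℝ (Fin 3) → EuclideanSpace ℝ (Fin 3) := fun y => fderiv ℝ v y (curl v y) with hs₁
  set s₂ : EuclideanSpace ℝ (Fin 3) → EuclideanSpace ℝ (Fin 3) := fun y => fderiv ℝ (curl v) y (curl v y)
    with hs₂
  set s₃ : EuclideanSpace ℝ (Fin 3) → EuclideanSpace ℝ (Fin 3) := fun y =>
    ∑ j, ⟪curl v y, fderiv ℝ v y (EuclideanSpace.basisFun (Fin 3) ℝ j)⟫ • EuclideanSpace.basisFun (Fin 3) ℝ j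
    with hs₃
  have c₁ : ContDiff ℝ ∞ s₁ := (hv.fderiv_right (m := ∞) le_rfl).clm_apply hω
  have c₂ : ContDiff ℝ ∞ s₂ := (hω.fderiv_right (m := ∞) le_rfl).clm_apply hω
  have c₃ : ContDiff ℝ ∞ s₃ :=
    ContDiff.sum fun j _ => (hω.inner ℝ ((hv.fderiv_right (m := ∞) le_rfl).clm_apply contDiff_const)).smul
      contDiff_const
  have hΔ : ContDiff ℝ 2 (Δ (curl v)) := contDiff_laplacian (n := 2) (hω.of_le (by norm_cast))
  set G : EuclideanSpace ℝ (Fin 3) → EuclideanSpace ℝ (Fin 3) := fun x =>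
    cJ • (curl (curl s₁) x - curl s₂ x + curl (curl s₃) x) + ca • curl (curl (curl v)) x -
      cc • curl (curl (Δ (curl v))) x with hG
  have hGc : Continuous G := by
    have k₁ : Continuous (curl (curl s₁)) := (contDiff_curl_top (contDiff_curl_top c₁)).continuous
    have k₂ : Continuous (curl s₂) := (contDiff_curl_top c₂).continuous
    have k₃ : Continuous (curl (curl s₃)) := (contDiff_curl_top (contDiff_curl_top c₃)).continuous
    have k₄ : Continuous (curl (curl (curl v))) := (contDiff_curl_top (contDiff_curl_top hω)).continuous
    have k₅ : Continuous (curl (curl (Δ (curl v)))) :=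
      continuous_curl (contDiff_curl (n := 1) (by exact_mod_cast hΔ))
    exact (((k₁.sub k₂).add k₃).const_smul cJ |>.add (k₄.const_smul ca)).sub (k₅.const_smul cc)
  refine ⟨G, hGc, fun η hη hηc => ?_⟩
  have hcη : ContDiff ℝ ∞ (curl η) := contDiff_curl_top hη
  have hcηc : HasCompactSupport (curl η) := hasCompactSupport_curl hηc
  -- split `J₁(curl η)` into its three terms
  obtain ⟨i1, -, -⟩ := integrable_stretching_coeffs (φ := curl η) hv hcη hcηc
  have cω := hω.continuous
  have cψ := hcη.continuous
  have cDv : Continuous (fderiv ℝ v) := hv.continuous_fderiv (by simp)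
  have cDψ : Continuous (fderiv ℝ (curl η)) := hcη.continuous_fderiv (by simp)
  have iT1 : Integrable (fun x => ⟪curl (curl η) x, fderiv ℝ v x (curl v x)⟫)
      (volume : Measure (EuclideanSpace ℝ (Fin 3))) :=
    integrable_of_vanish (φ := curl η) hcηc ((continuous_curl (hcη.of_le (by norm_cast))).inner
      (cDv.clm_apply cω)) fun x hx => by simp [(vanish_of_notMem_tsupport (φ := curl η) hx).2.1]
  have iT2 : Integrable (fun x => ⟪curl v x, fderiv ℝ (curl η) x (curl v x)⟫)
      (volume : Measure (EuclideanSpace ℝ (Fin 3))) :=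
    integrable_of_vanish (φ := curl η) hcηc (cω.inner (cDψ.clm_apply cω)) fun x hx => by
      simp [(vanish_of_notMem_tsupport (φ := curl η) hx).2.2.1]
  have iT3 : Integrable (fun x => ⟪curl v x, fderiv ℝ v x (curl (curl η) x)⟫)
      (volume : Measure (EuclideanSpace ℝ (Fin 3))) :=
    integrable_of_vanish (φ := curl η) hcηc (cω.inner (cDv.clm_apply
      (continuous_curl (hcη.of_le (by norm_cast))))) fun x hx => by
      simp [(vanish_of_notMem_tsupport (φ := curl η) hx).2.1]
  have hJ1 : (∫ x, (⟪curl (curl η) x, fderiv ℝ v x (curl v x)⟫ + ⟪curl v x, fderiv ℝ (curl η) x (curl v x)⟫ +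
          ⟪curl v x, fderiv ℝ v x (curl (curl η) x)⟫)) =
      (∫ x, ⟪curl (curl s₁) x, η x⟫) - (∫ x, ⟪curl s₂ x, η x⟫) + ∫ x, ⟪curl (curl s₃) x, η x⟫ := by
    rw [integral_add ?_ iT3, integral_add iT1 iT2, integral_T1 hv hη hηc, integral_T2 hv hη hηc,
      integral_T3 hv hη hηc]
    · ring
    · exact iT1.add iT2
  rw [hJ1, integral_A1 hv hη hηc, integral_C1 hv hη hηc]
  -- expand `∫⟪G, η⟫`
  have iG : ∀ {F : EuclideanSpace ℝ (Fin 3) → EuclideanSpace ℝ (Fin 3)}, Continuous F →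
      Integrable (fun x => ⟪F x, η x⟫) (volume : Measure (EuclideanSpace ℝ (Fin 3))) := fun hF =>
    integrable_inner_of_hasCompactSupport_right hF hη.continuous hηc
  have k₁ : Continuous (curl (curl s₁)) := (contDiff_curl_top (contDiff_curl_top c₁)).continuous
  have k₂ : Continuous (curl s₂) := (contDiff_curl_top c₂).continuous
  have k₃ : Continuous (curl (curl s₃)) := (contDiff_curl_top (contDiff_curl_top c₃)).continuous
  have k₄ : Continuous (curl (curl (curl v))) := (contDiff_curl_top (contDiff_curl_top hω)).continuous
  have k₅ : Continuous (curl (curl (Δ (curl v)))) :=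
    continuous_curl (contDiff_curl (n := 1) (by exact_mod_cast hΔ))
  have hpt : ∀ x, ⟪G x, η x⟫ = cJ * (⟪curl (curl s₁) x, η x⟫ - ⟪curl s₂ x, η x⟫ + ⟪curl (curl s₃) x, η x⟫) +
      ca * ⟪curl (curl (curl v)) x, η x⟫ - cc * ⟪curl (curl (Δ (curl v))) x, η x⟫ := fun x => by
    simp only [hG, inner_sub_left, inner_add_left, inner_smul_left, RCLike.conj_to_real]
  rw [integral_congr_ae (Eventually.of_forall hpt), integral_sub ?_ ?_, integral_add ?_ ?_,
    integral_const_mul, integral_const_mul, integral_const_mul, integral_add ?_ ?_, integral_sub ?_ ?_]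
  · ring
  all_goals first
    | exact iG k₁ | exact iG k₂ | exact iG k₃ | exact iG k₄ | exact iG k₅
    | exact (iG k₁).sub (iG k₂) | exact ((iG k₁).sub (iG k₂)).add (iG k₃)
    | exact (((iG k₁).sub (iG k₂)).add (iG k₃)).const_mul cJ | exact (iG k₄).const_mul ca
    | exact (iG k₅).const_mul cc
    | exact ((((iG k₁).sub (iG k₂)).add (iG k₃)).const_mul cJ).add ((iG k₄).const_mul ca)

end Density

end DepletionLadder.KStar

end Summit.NavierStokesRegularity.NavierStokesRegularity.Theorems

end
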